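import Summits.CriticalPhenomena.PercolationContinuityZ3.Theorems.Transplant.SkelPhiNegReachRoomsAB
import HarnessLib

/-!
# N1 (the `{±1}` node), (C) column under (ζ′) — file (C-S9a-K): THE READING CRITERIA WITH THE BOX MULTIPLIER `kq`
# (the twin of `SkelPhiNegReachReadB` (C-S9a, p300056) with the literal `40` = strides per `r` replaced by `40·kq`): when the cell map's resolutions
# are commensurate with the long lattice in the (ζ′) form **`c_i'·A·(40·kq·Δ) = r_i·D`** (`Δ = modulus n h v_α v_β`; one stride reads `r_i/(40·kq)` fine
# units — stmt-g16's `NegB.hsc_RA` with `K = 40·Kq`, NEG-SCOPE §B.19 (ζ′): `A := 800·Kq`, stride := `s∥`), the four reading inequalities of a run box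
# `[lo, hi]` of the frame `runX φ c₀ n h 1` reduce to integer inequalities without divisions: `X ≤ rdLo₁ ⟸ 40kq·Δ·X ≤ r₁·U·lo₁`,
# `rdHi₁ ≤ Y ⟸ r₁·(U·hi₁ + U − 1) < 40kq·Δ·Y`, `X ≤ rdLo₀ ⟸ 40kq·Δ·n·X + r₀·n ≤ r₀·(Δ·lo₀ − M⁺)`, `rdHi₀ ≤ Y ⟸ r₀·(Δ·hi₀ − M⁻) < 40kq·Δ·n·Y`;
# and the packaged room lemma **`rooms_smallK`**: a box within `±X₀ × ±X₁` run units with `Δ·X₀ + |v_α|·U·(X₁+1) ≤ 76kq·Δ·n`, `U·(X₁+1) ≤ 77kq·Δ`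
# reads inside `±(2r_i − 1)` on both axes (`40·kq ≤ r_i`). The case `kq = 1` is the record (C-S9a).

builds on p205010 (kernel theorem, internal audit signed; external expert review pending) — nothing in this file uses p205010; nothing here is a
claim about the open node `SamePDropOfSkeletonNeg₁`.
Lane `prim-bschramm`, seat `prim-bschramm-p5` (gen 11; (C) lineage); helper file (`--supports stmt-CriticalPhenomena-4575`).
[cite: KozmaNitzan2024, §4 Lemma 12 (pp. 23–25), p. 26 (Q_v, M_v, H_{v,x})] [cite: MartineauTassion2017, §4.1]
-/

noncomputable section

namespace Summit.CriticalPhenomena.PercolationContinuityZ3.Theorems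

namespace Transplant

namespace Skelφ

open Literature.Probability.Percolation Literature.Probability.LatticeModels
open Literature.Probability.Percolation.KozmaNitzan.Cells (oth oth_ne sgOf sgOf_sign eq_oth_of_ne)
open TwoAxis.Para (modulus)
open ChainPlanar ChainPara

section Criteria

variable {A : ℤ} {n : ℕ} {h vα vβ c₀' c₁' D : ℤ} {P : PCells2} {kq : ℕ}
  (hn : 1 ≤ n) (hA : 0 < A) (hD : 0 < D) (hm : 0 < modulus n h vα vβ) (hc₀ : 0 < c₀') (hc₁ : 0 < c₁') (hkq : 1 ≤ kq)
  (hsc0 : c₀' * A * (40 * (kq : ℤ) * modulus n h vα vβ) = (P.r 0 : ℤ) * D)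
  (hsc1 : c₁' * A * (40 * (kq : ℤ) * modulus n h vα vβ) = (P.r 1 : ℤ) * D)

/-! ## §1 The four reading criteria at `40·kq` strides per `r` -/

include hD hm hkq hsc1 in
/-- **Axis-`1` lower criterion**: `40kq·Δ·X ≤ r₁·U·lo₁ ⟹ X ≤ rdLo₁`. [this work] -/
theorem rdLo_one_geK {lo hi : Site 2} {X : ℤ} (hX : 40 * (kq : ℤ) * modulus n h vα vβ * X ≤ (P.r 1 : ℤ) * ((shearUnit n h : ℤ) * lo 1)) :
    X ≤ rdLo A n h vα vβ c₀' c₁' D lo hi 1 := by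
  rw [rdLo_one, Int.le_ediv_iff_mul_le hD]
  have hkq' : (0 : ℤ) < kq := by exact_mod_cast hkq
  have h40 : (0 : ℤ) < 40 * (kq : ℤ) * modulus n h vα vβ := mul_pos (mul_pos (by norm_num) hkq') hm
  refine le_of_mul_le_mul_right ?_ h40
  have e : c₁' * (A * ((shearUnit n h : ℤ) * lo 1)) * (40 * (kq : ℤ) * modulus n h vα vβ) = (P.r 1 : ℤ) * ((shearUnit n h : ℤ) * lo 1) * D := by
    linear_combination ((shearUnit n h : ℤ) * lo 1) * hsc1
  rw [e]
  have := mul_le_mul_of_nonneg_right hX hD.le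
  linarith

include hD hm hkq hsc1 in
/-- **Axis-`1` upper criterion**: `r₁·(U·hi₁ + U − 1) < 40kq·Δ·Y ⟹ rdHi₁ ≤ Y`. [this work] -/
theorem rdHi_one_leK {lo hi : Site 2} {Y : ℤ} (hY : (P.r 1 : ℤ) * ((shearUnit n h : ℤ) * hi 1 + shearUnit n h - 1) < 40 * (kq : ℤ) * modulus n h vα vβ * Y) :
    rdHi A n h vα vβ c₀' c₁' D lo hi 1 ≤ Y := by
  rw [rdHi_one]
  suffices hlt : (c₁' * (A * ((shearUnit n h : ℤ) * hi 1 + shearUnit n h - 1))) / D < Y by omega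
  rw [Int.ediv_lt_iff_lt_mul hD]
  have hkq' : (0 : ℤ) < kq := by exact_mod_cast hkq
  have h40 : (0 : ℤ) < 40 * (kq : ℤ) * modulus n h vα vβ := mul_pos (mul_pos (by norm_num) hkq') hm
  refine lt_of_mul_lt_mul_right ?_ h40.le
  have e : c₁' * (A * ((shearUnit n h : ℤ) * hi 1 + shearUnit n h - 1)) * (40 * (kq : ℤ) * modulus n h vα vβ) =
      (P.r 1 : ℤ) * ((shearUnit n h : ℤ) * hi 1 + shearUnit n h - 1) * D := by
    linear_combination ((shearUnit n h : ℤ) * hi 1 + shearUnit n h - 1) * hsc1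
  rw [e]
  have := mul_lt_mul_of_pos_right hY hD
  linarith

include hn hA hD hm hc₀ hkq hsc0 in
/-- **Axis-`0` lower criterion**: `40kq·Δ·n·X + r₀·n ≤ r₀·(Δ·lo₀ − M⁺) ⟹ X ≤ rdLo₀` (the inner floor `⌊·/n⌋` costs at most `r₀·n/A ≤ r₀·n`). [this work] -/
theorem rdLo_zero_geK {lo hi : Site 2} {X : ℤ}
    (hX : 40 * (kq : ℤ) * modulus n h vα vβ * (n * X) + (P.r 0 : ℤ) * n ≤
      (P.r 0 : ℤ) * (modulus n h vα vβ * lo 0 - max (vα * ((shearUnit n h : ℤ) * lo 1)) (vα * ((shearUnit n h : ℤ) * hi 1 + shearUnit n h - 1)))) :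
    X ≤ rdLo A n h vα vβ c₀' c₁' D lo hi 0 := by
  rw [rdLo_zero, Int.le_ediv_iff_mul_le hD]
  set Z := modulus n h vα vβ * lo 0 - max (vα * ((shearUnit n h : ℤ) * lo 1)) (vα * ((shearUnit n h : ℤ) * hi 1 + shearUnit n h - 1)) with hZ
  have hn0 : (0 : ℤ) < n := by exact_mod_cast hn
  have hkq' : (0 : ℤ) < kq := by exact_mod_cast hkq
  have h40 : (0 : ℤ) < 40 * (kq : ℤ) * modulus n h vα vβ := mul_pos (mul_pos (by norm_num) hkq') hm
  have hr : (0 : ℤ) ≤ P.r 0 := by positivity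
  -- the inner floor: `n·⌊A Z/n⌋ ≥ A Z − n + 1`
  have hfl : A * Z - n + 1 ≤ (n : ℤ) * (A * Z / n) := by
    have := Int.lt_mul_ediv_self_add (x := A * Z) hn0; linarith
  -- `40kq·Δ·c₀' ≤ r₀·D` (from `c₀'·A·40kqΔ = r₀·D`, `1 ≤ A`)
  have hcD : c₀' * (40 * (kq : ℤ) * modulus n h vα vβ) ≤ (P.r 0 : ℤ) * D := by
    have h1 : c₀' * (40 * (kq : ℤ) * modulus n h vα vβ) * 1 ≤ c₀' * (40 * (kq : ℤ) * modulus n h vα vβ) * A :=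
      mul_le_mul_of_nonneg_left (by omega) (mul_pos hc₀ h40).le
    have e : c₀' * (40 * (kq : ℤ) * modulus n h vα vβ) * A = (P.r 0 : ℤ) * D := by linear_combination hsc0
    linarith
  refine le_of_mul_le_mul_left ?_ hn0
  refine le_of_mul_le_mul_right ?_ h40
  have key : (n : ℤ) * (X * D) * (40 * (kq : ℤ) * modulus n h vα vβ) ≤ (c₀' * (40 * (kq : ℤ) * modulus n h vα vβ)) * ((n : ℤ) * (A * Z / n)) :=
    calc (n : ℤ) * (X * D) * (40 * (kq : ℤ) * modulus n h vα vβ) = D * (40 * (kq : ℤ) * modulus n h vα vβ * (n * X)) := by ring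
      _ ≤ D * ((P.r 0 : ℤ) * Z - (P.r 0 : ℤ) * n) := mul_le_mul_of_nonneg_left (by linarith) hD.le
      _ = (P.r 0 : ℤ) * D * Z - (P.r 0 : ℤ) * D * n := by ring
      _ ≤ (P.r 0 : ℤ) * D * Z - c₀' * (40 * (kq : ℤ) * modulus n h vα vβ) * n := by nlinarith [mul_le_mul_of_nonneg_right hcD hn0.le]
      _ ≤ (P.r 0 : ℤ) * D * Z - c₀' * (40 * (kq : ℤ) * modulus n h vα vβ) * (n - 1) := by nlinarith [mul_pos hc₀ h40]
      _ = (c₀' * (40 * (kq : ℤ) * modulus n h vα vβ)) * (A * Z - n + 1) := by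
          have e : c₀' * (40 * (kq : ℤ) * modulus n h vα vβ) * A = (P.r 0 : ℤ) * D := by linear_combination hsc0
          linear_combination (-Z) * e
      _ ≤ (c₀' * (40 * (kq : ℤ) * modulus n h vα vβ)) * ((n : ℤ) * (A * Z / n)) := mul_le_mul_of_nonneg_left hfl (mul_pos hc₀ h40).le
  calc (n : ℤ) * (X * D) * (40 * (kq : ℤ) * modulus n h vα vβ) ≤ (c₀' * (40 * (kq : ℤ) * modulus n h vα vβ)) * ((n : ℤ) * (A * Z / n)) := key
    _ = (n : ℤ) * (c₀' * (A * Z / n)) * (40 * (kq : ℤ) * modulus n h vα vβ) := by ring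

include hn hD hm hc₀ hkq hsc0 in
/-- **Axis-`0` upper criterion**: `r₀·(Δ·hi₀ − M⁻) < 40kq·Δ·n·Y ⟹ rdHi₀ ≤ Y`. [this work] -/
theorem rdHi_zero_leK {lo hi : Site 2} {Y : ℤ}
    (hY : (P.r 0 : ℤ) * (modulus n h vα vβ * hi 0 - min (vα * ((shearUnit n h : ℤ) * lo 1)) (vα * ((shearUnit n h : ℤ) * hi 1 + shearUnit n h - 1))) <
      40 * (kq : ℤ) * modulus n h vα vβ * (n * Y)) :
    rdHi A n h vα vβ c₀' c₁' D lo hi 0 ≤ Y := by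
  rw [rdHi_zero]
  set Z := modulus n h vα vβ * hi 0 - min (vα * ((shearUnit n h : ℤ) * lo 1)) (vα * ((shearUnit n h : ℤ) * hi 1 + shearUnit n h - 1)) with hZ
  suffices hlt : (c₀' * (A * Z / n)) / D < Y by omega
  rw [Int.ediv_lt_iff_lt_mul hD]
  have hn0 : (0 : ℤ) < n := by exact_mod_cast hn
  have hkq' : (0 : ℤ) < kq := by exact_mod_cast hkq
  have h40 : (0 : ℤ) < 40 * (kq : ℤ) * modulus n h vα vβ := mul_pos (mul_pos (by norm_num) hkq') hm
  have hfl : (n : ℤ) * (A * Z / n) ≤ A * Z := Int.mul_ediv_self_le hn0.ne'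
  refine lt_of_mul_lt_mul_left (a := (n : ℤ)) ?_ hn0.le
  refine lt_of_mul_lt_mul_right ?_ h40.le
  have e : c₀' * (40 * (kq : ℤ) * modulus n h vα vβ) * A = (P.r 0 : ℤ) * D := by linear_combination hsc0
  calc (n : ℤ) * (c₀' * (A * Z / n)) * (40 * (kq : ℤ) * modulus n h vα vβ) = (c₀' * (40 * (kq : ℤ) * modulus n h vα vβ)) * ((n : ℤ) * (A * Z / n)) := by ring
    _ ≤ (c₀' * (40 * (kq : ℤ) * modulus n h vα vβ)) * (A * Z) := mul_le_mul_of_nonneg_left hfl (mul_pos hc₀ h40).le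
    _ = D * ((P.r 0 : ℤ) * Z) := by linear_combination Z * e
    _ < D * (40 * (kq : ℤ) * modulus n h vα vβ * (n * Y)) := mul_lt_mul_of_pos_left hY hD
    _ = (n : ℤ) * (Y * D) * (40 * (kq : ℤ) * modulus n h vα vβ) := by ring

/-! ## §2 Small boxes read inside `±(2r − 1)` on both axes (`40·kq ≤ r_i`) -/

include hn hA hD hm hc₀ hkq hsc0 hsc1 in
/-- **A small run box reads inside `±(2r_i − 1)` on both axes**: if `lo₀ ≥ −X₀`, `hi₀ ≤ X₀`, `|lo₁|, |hi₁| ≤ X₁` with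
`Δ·X₀ + |v_α|·U·(X₁ + 1) ≤ 76kq·Δ·n` and `U·(X₁ + 1) ≤ 77kq·Δ`, then `−(2r_i) + 1 ≤ rdLo_i` and `rdHi_i ≤ 2r_i − 1` for `i = 0, 1` (`r_i ≥ 40kq`).
[this work] -/
theorem rooms_smallK (hr40 : ∀ i, 40 * (kq : ℤ) ≤ (P.r i : ℤ)) {lo hi : Site 2} {X₀ X₁ : ℤ} (h0l : -X₀ ≤ lo 0) (h0h : hi 0 ≤ X₀) (h1l : |lo 1| ≤ X₁)
    (h1h : |hi 1| ≤ X₁) (hS₀ : modulus n h vα vβ * X₀ + |vα| * ((shearUnit n h : ℤ) * (X₁ + 1)) ≤ 76 * (kq : ℤ) * modulus n h vα vβ * n)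
    (hS₁ : (shearUnit n h : ℤ) * (X₁ + 1) ≤ 77 * (kq : ℤ) * modulus n h vα vβ) (i : Fin 2) :
    -(2 * (P.r i : ℤ)) + 1 ≤ rdLo A n h vα vβ c₀' c₁' D lo hi i ∧ rdHi A n h vα vβ c₀' c₁' D lo hi i ≤ 2 * (P.r i : ℤ) - 1 := by
  have hr0 : 40 * (kq : ℤ) ≤ P.r 0 := hr40 0
  have hr1 : 40 * (kq : ℤ) ≤ P.r 1 := hr40 1
  have hkq' : (1 : ℤ) ≤ kq := by exact_mod_cast hkq
  have hΔ : (0 : ℤ) < modulus n h vα vβ := hm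
  have hΔ1 : (1 : ℤ) ≤ modulus n h vα vβ := hm
  have hU : (0 : ℤ) ≤ shearUnit n h := by positivity
  have hn1 : (1 : ℤ) ≤ n := by exact_mod_cast hn
  have hX₁ : 0 ≤ X₁ := (abs_nonneg _).trans h1l
  have hr0' : (0 : ℤ) ≤ P.r 0 := by linarith
  have hr1' : (0 : ℤ) ≤ P.r 1 := by linarith
  set C := |vα| * ((shearUnit n h : ℤ) * (X₁ + 1)) with hC
  have hC0 : 0 ≤ C := by positivity
  have hmax : max (vα * ((shearUnit n h : ℤ) * lo 1)) (vα * ((shearUnit n h : ℤ) * hi 1 + shearUnit n h - 1)) ≤ C :=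
    max_le ((le_abs_self _).trans (mixed_le hn hm h1l).1) ((le_abs_self _).trans (mixed_le hn hm h1h).2)
  have hmin : -C ≤ min (vα * ((shearUnit n h : ℤ) * lo 1)) (vα * ((shearUnit n h : ℤ) * hi 1 + shearUnit n h - 1)) :=
    le_min ((neg_le_neg (mixed_le hn hm h1l).1).trans (neg_abs_le _)) ((neg_le_neg (mixed_le hn hm h1h).2).trans (neg_abs_le _))
  -- product facts for the scaled constants
  have hΔn : (0 : ℤ) ≤ modulus n h vα vβ * n := by positivity
  have k0a : 40 * (kq : ℤ) * (modulus n h vα vβ * n) ≤ modulus n h vα vβ * n * (P.r 0 : ℤ) := by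
    have := mul_le_mul_of_nonneg_left hr0 hΔn; linarith
  have k0b : modulus n h vα vβ * n * (P.r 0 : ℤ) ≤ (kq : ℤ) * (modulus n h vα vβ * n * (P.r 0 : ℤ)) := by
    have := mul_le_mul_of_nonneg_left hkq' (show (0 : ℤ) ≤ modulus n h vα vβ * n * (P.r 0 : ℤ) by positivity); linarith
  have k0c : (P.r 0 : ℤ) * n ≤ modulus n h vα vβ * n * (P.r 0 : ℤ) := by
    have := mul_le_mul_of_nonneg_left hΔ1 (show (0 : ℤ) ≤ n * (P.r 0 : ℤ) by positivity); linarith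
  have k0d : (0 : ℤ) ≤ modulus n h vα vβ * n * (P.r 0 : ℤ) := by positivity
  have k1a : 40 * (kq : ℤ) * modulus n h vα vβ ≤ modulus n h vα vβ * (P.r 1 : ℤ) := by
    have := mul_le_mul_of_nonneg_left hr1 hΔ.le; linarith
  have k1b : modulus n h vα vβ * (P.r 1 : ℤ) ≤ (kq : ℤ) * (modulus n h vα vβ * (P.r 1 : ℤ)) := by
    have := mul_le_mul_of_nonneg_left hkq' (show (0 : ℤ) ≤ modulus n h vα vβ * (P.r 1 : ℤ) by positivity); linarith
  have k1c : (0 : ℤ) ≤ modulus n h vα vβ * (P.r 1 : ℤ) := by positivity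
  fin_cases i
  · -- axis 0
    constructor
    · refine rdLo_zero_geK hn hA hD hm hc₀ hkq hsc0 ?_
      show 40 * (kq : ℤ) * modulus n h vα vβ * (n * (-(2 * (P.r 0 : ℤ)) + 1)) + (P.r 0 : ℤ) * n ≤ _
      have h1 : (P.r 0 : ℤ) * (modulus n h vα vβ * (-X₀) - C) ≤
          (P.r 0 : ℤ) * (modulus n h vα vβ * lo 0 - max (vα * ((shearUnit n h : ℤ) * lo 1)) (vα * ((shearUnit n h : ℤ) * hi 1 + shearUnit n h - 1))) :=
        mul_le_mul_of_nonneg_left (by have := mul_le_mul_of_nonneg_left h0l hΔ.le; linarith) hr0'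
      have h2 : (P.r 0 : ℤ) * (modulus n h vα vβ * X₀ + C) ≤ (P.r 0 : ℤ) * (76 * (kq : ℤ) * modulus n h vα vβ * n) := mul_le_mul_of_nonneg_left hS₀ hr0'
      linarith
    · refine rdHi_zero_leK hn hD hm hc₀ hkq hsc0 ?_
      show (P.r 0 : ℤ) * _ < 40 * (kq : ℤ) * modulus n h vα vβ * (n * (2 * (P.r 0 : ℤ) - 1))
      have h1 : (P.r 0 : ℤ) * (modulus n h vα vβ * hi 0 - min (vα * ((shearUnit n h : ℤ) * lo 1)) (vα * ((shearUnit n h : ℤ) * hi 1 + shearUnit n h - 1))) ≤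
          (P.r 0 : ℤ) * (modulus n h vα vβ * X₀ + C) :=
        mul_le_mul_of_nonneg_left (by have := mul_le_mul_of_nonneg_left h0h hΔ.le; linarith) hr0'
      have h2 : (P.r 0 : ℤ) * (modulus n h vα vβ * X₀ + C) ≤ (P.r 0 : ℤ) * (76 * (kq : ℤ) * modulus n h vα vβ * n) := mul_le_mul_of_nonneg_left hS₀ hr0'
      have h3 : 0 < modulus n h vα vβ * n * (P.r 0 : ℤ) := by
        have : (0 : ℤ) < P.r 0 := by linarith
        positivity
      linarith
  · -- axis 1
    have hl1 := (abs_le.1 h1l).1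
    have hh1 := (abs_le.1 h1h).2
    constructor
    · refine rdLo_one_geK hD hm hkq hsc1 ?_
      show 40 * (kq : ℤ) * modulus n h vα vβ * (-(2 * (P.r 1 : ℤ)) + 1) ≤ (P.r 1 : ℤ) * ((shearUnit n h : ℤ) * lo 1)
      have h1 : (P.r 1 : ℤ) * ((shearUnit n h : ℤ) * (-X₁)) ≤ (P.r 1 : ℤ) * ((shearUnit n h : ℤ) * lo 1) :=
        mul_le_mul_of_nonneg_left (mul_le_mul_of_nonneg_left hl1 hU) hr1'
      have h2 : (P.r 1 : ℤ) * ((shearUnit n h : ℤ) * (X₁ + 1)) ≤ (P.r 1 : ℤ) * (77 * (kq : ℤ) * modulus n h vα vβ) := mul_le_mul_of_nonneg_left hS₁ hr1'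
      have h4 : (0 : ℤ) ≤ (P.r 1 : ℤ) * (shearUnit n h : ℤ) := by positivity
      linarith
    · refine rdHi_one_leK hD hm hkq hsc1 ?_
      show (P.r 1 : ℤ) * ((shearUnit n h : ℤ) * hi 1 + shearUnit n h - 1) < 40 * (kq : ℤ) * modulus n h vα vβ * (2 * (P.r 1 : ℤ) - 1)
      have h1 : (P.r 1 : ℤ) * ((shearUnit n h : ℤ) * hi 1 + shearUnit n h - 1) ≤ (P.r 1 : ℤ) * ((shearUnit n h : ℤ) * (X₁ + 1) - 1) :=
        mul_le_mul_of_nonneg_left (by have := mul_le_mul_of_nonneg_left hh1 hU; linarith) hr1'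
      have h2 : (P.r 1 : ℤ) * ((shearUnit n h : ℤ) * (X₁ + 1)) ≤ (P.r 1 : ℤ) * (77 * (kq : ℤ) * modulus n h vα vβ) := mul_le_mul_of_nonneg_left hS₁ hr1'
      have h3 : (0 : ℤ) < P.r 1 := by linarith
      linarith

end Criteria

end Skelφ

end Transplant

end Summit.CriticalPhenomena.PercolationContinuityZ3.Theorems

end
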